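import Summits.ABC.IUTFork.Thm311Multirad
import HarnessLib

/-!
# [IUTchIII] Theorem 3.11 in the author's terms, C: (ii) log-Kummer Correspondence and (Ind3)

Record-only file (D-0012) of the abc-iut cell (seat abc-iut-c312-1); TAKES NO SIDE. Sequel to
`Thm311Sig` (A) and `Thm311Multirad` (B). This file types [IUTchIII] Theorem 3.11 (ii) (kurims
pp. 155–156), one declaration per printed sub-item, over a SIGNATURE `Column S n` for the Frobenius-like
data of the `n`-th column `{^{n,m}HT^{Θ±ell NF}}_{m ∈ ℤ}` of the LGP-Gaussian log-theta-lattice AS SEEN ON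
THE CORIC PACKETS through the Kummer isomorphisms:

(ii) "For `n, m ∈ ℤ`, the Kummer isomorphisms of labeled data `Ψ_cns(^{n,m}F_≻)_t ⥲ Ψ_cns(^{n,∘}D_≻)_t`;
`{π_1^{κ-sol}(^{n,m}D^⊛) ↷ ^{n,m}M^⊛_{∞κ}}_j ⥲ {π_1^{κ-sol}(^{n,∘}D^⊛) ↷ M^⊛_{∞κ}(^{n,∘}D^⊚)}_j`;
`(^{n,m}M^⊛_mod)_j ⥲ M^⊛_mod(^{n,∘}D^⊚)_j` … of [IUTchII], Corollary 4.6, (iii); [IUTchII], Corollary 4.8,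
(i), (ii) … induce isomorphisms between the vertically coric data (a), (b), (c) of (i) [… not yet …
subjected to the indeterminacies (Ind1), (Ind2) …] and the corresponding data arising from each
`Θ±ell NF`-Hodge theater `^{n,m}HT^{Θ±ell NF}`, i.e.: (a) … isomorphisms with local mono-analytic tensor
packets and their `ℚ`-spans … all of which are compatible with the respective log-volumes [cf.
Proposition 3.9, (ii)]; (b) for `V^bad ∋ v`, isomorphisms of splitting monoids
`Ψ^⊥_{F_LGP}(^{n,m}HT^{Θ±ell NF})_v ⥲ Ψ^⊥_{LGP}(^{n,∘}HT^{D-Θ±ell NF})_v`; (c) for `j ∈ F_l^⋇`, isomorphisms of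
number fields and global non-realified/realified Frobenioids … [which] induce isomorphisms of the global
realified Frobenioid portions `^{n,m}C^⊩_LGP ⥲ C^⊩_LGP(^{n,∘}HT^{D-Θ±ell NF})`; `^{n,m}C^⊩_lgp ⥲ C^⊩_lgp(…)` …
Moreover, as one varies `m ∈ ℤ`, the various isomorphisms of (b) and of the first line in the first
display of (c) are mutually compatible with one another, relative to the log-links of the `n`-th column
…, in the sense that the only portions of the domains of these isomorphisms that are possibly related to
one another via the log-links consist of roots of unity in the domains of the log-links [multiplication
by which corresponds, via the log-link, to an "addition by zero" indeterminacy, i.e., to no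
indeterminacy!] … On the other hand, the isomorphisms of (a) are subject to a certain "indeterminacy" as
follows: (Ind3) as one varies `m ∈ ℤ`, the isomorphisms of (a) are "upper semi-compatible", relative to
the log-links of the `n`-th column of the LGP-Gaussian log-theta-lattice under consideration, in a sense
that involves certain natural inclusions "⊆" at `v_ℚ ∈ V^non_ℚ` and certain natural surjections "↠" at
`v_ℚ ∈ V^arc_ℚ` — cf. Proposition 3.5, (ii), (a), (b), for more details. Finally, as one varies `m ∈ ℤ`,
the isomorphisms of (a) are [precisely!] compatible, relative to the log-links …, with the respective
log-volumes [cf. Proposition 3.9, (iv)]."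

What is typed how. The Kummer isomorphisms of (a) identify, for every `m`, the holomorphic packet
`I^ℚ(^{S^±_{j+1}};^{n,m}F_{v_ℚ})` with the coric packet `I^ℚ(^{S^±_{j+1}};^{n,∘}D⊢_{v_ℚ})`; the signature records
their EFFECT: the transported holomorphic log-volume (`frobLogvol m`), the transported splitting
monoids (`frobΨ m`) and number fields (`frobMmod m`), and — the data (Ind3) is about — the images
`unitImage m m'` in the coric packet of the unit groups `(Ψ_cns(^{n,m}F_≻)_{|t|})^×_v` "via both (1) the
tensor product, over such `|t|`, of the [relevant] Kummer isomorphisms …, and (2) the tensor product …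
of the pre-composite of these Kummer isomorphisms with the `m'`-th iterates … of the log-links"
(Prop. 3.5 (ii) (a)), and at archimedean `v_ℚ` the images `ballImage m` of "the closed balls of radius
`π`" (Prop. 3.5 (ii) (b)). Then: `KummerA` = (a)'s log-volume compatibility; `KummerB`, `KummerC` = the
isomorphisms of (b), (c) land ON the vertically coric data; `MutualCompat` = the mutual compatibility
of (b)/(c) as `m` varies, read as invariance under the translation symmetries `m ↦ m+1` of the column
(Prop. 3.5, end: "which is invariant with respect to the translation symmetries … of the `n`-th
column"); `Ind3` = the containments of Prop. 3.5 (ii) (a), (b) (upper bounds only — "upper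
semi-compatible"); `LogvolPrecise` = the final clause; `logvolPrecise_of_kummerA` PROVES the final
clause from (a) at each `m` (bookkeeping: both read the same coric log-volume).

Sources read on the page: [IUTchIII] pp. 103–106 (Prop. 3.5), 112 (Def. 3.8 (i)), 115–117
(Prop. 3.9), 147–149 (Prop. 3.10), 155–156 (Thm. 3.11 (ii)). [claim: Mochizuki2012, status: disputed]
Deliberately NOT here: the log-link itself ([IUTchIII] Def. 1.1 — TODO-merge: abc-iut-L6-t3), the
Kummer isomorphisms as maps of monoids ([IUTchII] Cor. 4.6/4.8 — abc-iut-L6-t2), (iii) (sequel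
`Thm311LinkCompat`); any judgement.
-/

noncomputable section

namespace Summit.ABC

namespace IUTFork

namespace Thm311

variable {T : ThetaIndex}

/-! ## 1. The Frobenius-like data of one column, seen on the coric packets -/

/-- SIGNATURE for the FROBENIUS-LIKE data of the `n`-th column `{^{n,m}HT^{Θ±ell NF}}_{m ∈ ℤ}` transported to
the coric packets of `L` by the Kummer isomorphisms of [IUTchIII] Thm. 3.11 (ii) (for (a): "isomorphisms
with local mono-analytic tensor packets and their `ℚ`-spans `I(^{S^±_{j+1}};^{n,m}F_{v_ℚ}) ⥲
I(^{S^±_{j+1}};^{n,m}F⊢×μ_{v_ℚ}) ⥲ I(^{S^±_{j+1}};^{n,∘}D⊢_{v_ℚ})` … [cf. Propositions 3.2, (i), (ii); 3.4, (ii);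
3.5, (i)]"), indexed by `m ∈ ℤ`:
`frobAdm m`/`frobLogvol m` = the holomorphic (packet- or procession-normalized) log-volume of Prop. 3.9 (i) at
`(n,m)` read on the coric packet; `frobΨ m` = the image of `Ψ^⊥_{F_LGP}(^{n,m}HT^{Θ±ell NF})_v` (Prop. 3.4 (ii),
3.5 (ii) (c)); `frobMmod m` = the image of `(^{n,m}M^⊛_mod)_j` (Prop. 3.10 (i)); `unitImage m m'` = the
image in `I^ℚ(^{S^±_{j+1}};^{n,∘}D⊢_{v_ℚ})` of the [Galois-invariant] unit groups `(Ψ_cns(^{n,m}F_≻)_{|t|})^×_v`,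
`|t| ∈ {0,…,j}`, `v | v_ℚ`, via the tensor product over `|t|` of the Kummer isomorphisms at `(n, m+m')`
pre-composed with the `m'`-th iterates of the log-links of the column (Prop. 3.5 (ii) (a) (1) for
`m' = 0`, (2) for `m' ≥ 1`); `ballImage m` = at `v_ℚ ∈ V^arc_ℚ` the image of "the closed balls of radius
`π` inside `(Ψ_cns(^{n,m}F_≻)_{|t|})^gp_v`" (Prop. 3.5 (ii) (b) (2)); `ObjLGP`/`frobObjLGP m`/`kumLGP m` (and
the `lgp` versions) = objects of the global realified Frobenioids `C^⊩_LGP(^{n,∘}HT^{D-Θ±ell NF})` and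
`^{n,m}C^⊩_LGP` with the induced isomorphism of (c) (Prop. 3.7 (iii)–(v), 3.10 (i)); `thetaPilot m` = the Θ-pilot object of
`^{n,m}C^⊩_LGP` (Def. 3.8 (i): "the object … determined by any collection, indexed by `v ∈ V^bad`, of
generators up to torsion of the monoids `Ψ^⊥_{F_lgp}(†HT^{Θ±ell NF})_v`"). TODO-merge: abc-iut-L6-t4
(Prop. 3.4, 3.5, 3.7, Def. 3.8, Prop. 3.9, 3.10), abc-iut-L6-t2 ([IUTchII] Cor. 4.6 (iii), 4.8 (i)(ii)),
abc-iut-L6-t3 ([IUTchIII] Def. 1.1 log-link). [claim: Mochizuki2012, status: disputed] -/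
structure Column (L : LogShells T) where
  /-- holomorphic admissibility `M(I^ℚ(^{S^±_{j+1}};^{n,m}F_{v_ℚ}))` read on the coric packet -/
  frobAdm : ℤ → ∀ (j : T.Label) (vQ : T.VQ), Set (L.Packet j vQ) → Prop
  /-- holomorphic log-volume at `(n,m)` read on the coric packet -/
  frobLogvol : ℤ → ∀ (j : T.Label) (vQ : T.VQ), Set (L.Packet j vQ) → ℝ
  /-- Kummer image of the Frobenius-like splitting monoid `Ψ^⊥_{F_LGP}(^{n,m}HT)_v`, `v ∈ V^bad` -/
  frobΨ : ℤ → ∀ v : T.V, v ∈ T.Vbad → Set (L.StarPacket v)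
  /-- Kummer image of the Frobenius-like number field `(^{n,m}M^⊛_mod)_j` -/
  frobMmod : ℤ → ∀ j : T.LabelStar, Set (L.GlobalPacket j.1)
  /-- images of the unit groups at `(n,m)` via Kummer at `(n,m+m')` ∘ (log-link)^{m'} -/
  unitImage : ℤ → ℕ → ∀ (j : T.Label) (vQ : T.VQ), Set (L.Packet j vQ)
  /-- images of the closed balls of radius `π` at archimedean `v_ℚ` -/
  ballImage : ℤ → ∀ (j : T.Label) (vQ : T.VQ), Set (L.Packet j vQ)
  /-- objects (up to isomorphism) of the vertically coric `C^⊩_LGP(^{n,∘}HT^{D-Θ±ell NF})` -/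
  ObjLGP : Type
  /-- objects (up to isomorphism) of the Frobenius-like `^{n,m}C^⊩_LGP` -/
  frobObjLGP : ℤ → Type
  /-- the isomorphism `^{n,m}C^⊩_LGP ⥲ C^⊩_LGP(^{n,∘}HT^{D-Θ±ell NF})` of (ii) (c) on objects -/
  kumLGP : ∀ m : ℤ, frobObjLGP m ≃ ObjLGP
  /-- objects (up to isomorphism) of the vertically coric `C^⊩_lgp(^{n,∘}HT^{D-Θ±ell NF})` (Prop. 3.7 (iv)) -/
  ObjLgp : Type
  /-- objects (up to isomorphism) of the Frobenius-like `^{n,m}C^⊩_lgp` -/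
  frobObjLgp : ℤ → Type
  /-- the isomorphism `^{n,m}C^⊩_lgp ⥲ C^⊩_lgp(^{n,∘}HT^{D-Θ±ell NF})` of (ii) (c) on objects -/
  kumLgp : ∀ m : ℤ, frobObjLgp m ≃ ObjLgp
  /-- the Θ-pilot object of `^{n,m}C^⊩_LGP` (Def. 3.8 (i)) -/
  thetaPilot : ∀ m : ℤ, frobObjLGP m

/-! ## 2. Theorem 3.11 (ii), one declaration per sub-item -/

namespace Column

variable {L : LogShells T} (C : Column L) (D : MRData L)

/-- **(ii) (a)** ([IUTchIII] Thm. 3.11 (ii) (a), p. 155): the Kummer isomorphisms of local mono-analytic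
tensor packets "`I(^{S^±_{j+1}};^{n,m}F_{v_ℚ}) ⥲ I(^{S^±_{j+1}};^{n,m}F⊢×μ_{v_ℚ}) ⥲ I(^{S^±_{j+1}};^{n,∘}D⊢_{v_ℚ})` …
[cf. Propositions 3.2, (i), (ii); 3.4, (ii); 3.5, (i)], all of which are compatible with the respective
log-volumes [cf. Proposition 3.9, (ii)]": for every `m`, the holomorphic log-volume read through the
Kummer isomorphism agrees with the mono-analytic log-volume of the data (a) on its admissible regions.
HYPOTHESIS. [claim: Mochizuki2012, status: disputed] -/
@[claim "Mochizuki2012" "disputed"] def KummerA : Prop :=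
  ∀ (m : ℤ) (j : T.Label) (vQ : T.VQ) (A : Set (L.Packet j vQ)),
    D.Adm j vQ A → C.frobAdm m j vQ A ∧ C.frobLogvol m j vQ A = D.logvol j vQ A

/-- **(ii) (b)** (p. 155): "for `V^bad ∋ v`, isomorphisms of splitting monoids
`Ψ^⊥_{F_LGP}(^{n,m}HT^{Θ±ell NF})_v ⥲ Ψ^⊥_{LGP}(^{n,∘}HT^{D-Θ±ell NF})_v` [cf. Proposition 3.5, (i); Proposition 3.5,
(ii), (c)]": for every `m` the Kummer image of the Frobenius-like splitting monoid IS the vertically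
coric splitting monoid of (i) (b). HYPOTHESIS. [claim: Mochizuki2012, status: disputed] -/
@[claim "Mochizuki2012" "disputed"] def KummerB : Prop :=
  ∀ (m : ℤ) (v : T.V) (hv : v ∈ T.Vbad), C.frobΨ m v hv = D.Ψ v hv

/-- **(ii) (c)** (p. 155–156): "for `j ∈ F_l^⋇`, isomorphisms of number fields and global
non-realified/realified Frobenioids `(^{n,m}M^⊛_MOD)_j ⥲ M^⊛_MOD(^{n,∘}HT^{D-Θ±ell NF})_j`;
`(^{n,m}M^⊛_mod)_j ⥲ M^⊛_mod(…)_j` … which are compatible with the respective natural isomorphisms between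
"MOD"- and "mod"-subscripted versions [cf. Proposition 3.10, (i)]; here, the isomorphisms of the third
line … induce isomorphisms of the global realified Frobenioid portions `^{n,m}C^⊩_LGP ⥲ C^⊩_LGP(…)`;
`^{n,m}C^⊩_lgp ⥲ C^⊩_lgp(…)` …": for every `m` the Kummer image of the Frobenius-like number field IS the
vertically coric one of (i) (c) (the Frobenioid isomorphisms are the signature fields `kumLGP`).
HYPOTHESIS. [claim: Mochizuki2012, status: disputed] -/
@[claim "Mochizuki2012" "disputed"] def KummerC : Prop :=
  ∀ (m : ℤ) (j : T.LabelStar), C.frobMmod m j = D.Mmod j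

/-- **(ii), mutual compatibility** (p. 156): "as one varies `m ∈ ℤ`, the various isomorphisms of (b) and
of the first line in the first display of (c) are mutually compatible with one another, relative to the
log-links of the `n`-th column …, in the sense that the only portions of the domains of these isomorphisms
that are possibly related to one another via the log-links consist of roots of unity in the domains of the
log-links [multiplication by which corresponds, via the log-link, to an "addition by zero" indeterminacy,
i.e., to no indeterminacy!] … This mutual compatibility … implies a corresponding mutual compatibility
between the isomorphisms of the second and third lines … that involve the subscript "MOD" [but not …
"mod"! — cf. Proposition 3.10, (iii); Remark 3.10.1]." READING (Prop. 3.5 (ii), end: the resulting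
log-Kummer correspondence "is invariant with respect to the translation symmetries … of the `n`-th
column"): the transported splitting monoids and number fields do not depend on `m`. HYPOTHESIS.
[claim: Mochizuki2012, status: disputed] -/
@[claim "Mochizuki2012" "disputed"] def MutualCompat : Prop :=
  (∀ (m : ℤ) (v : T.V) (hv : v ∈ T.Vbad), C.frobΨ (m + 1) v hv = C.frobΨ m v hv) ∧
  ∀ (m : ℤ) (j : T.LabelStar), C.frobMmod (m + 1) j = C.frobMmod m j

/-- **(Ind3)** ([IUTchIII] Thm. 3.11 (ii), p. 156): "as one varies `m ∈ ℤ`, the isomorphisms of (a) are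
"upper semi-compatible", relative to the log-links of the `n`-th column of the LGP-Gaussian
log-theta-lattice under consideration, in a sense that involves certain natural inclusions "⊆" at
`v_ℚ ∈ V^non_ℚ` and certain natural surjections "↠" at `v_ℚ ∈ V^arc_ℚ` — cf. Proposition 3.5, (ii), (a),
(b)". Prop. 3.5 (ii) (a): at `v_ℚ ∈ V^non_ℚ` "the topological module `I(^{S^±_{j+1}}F(^{n,∘}D_≻)_{v_ℚ})` …
contains the images of the submodules of Galois invariants … of the groups of units
`(Ψ_cns(^{n,m}F_≻)_{|t|})^×_v`, for `V ∋ v | v_ℚ` and `|t| ∈ {0, …, j}`, via both (1) the tensor product, over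
such `|t|`, of the [relevant] Kummer isomorphisms …, and (2) the tensor product, over such `|t|`, of the
pre-composite of these Kummer isomorphisms with the `m'`-th iterates … of the log-links, for `m' ≥ 1`";
(b): at `v_ℚ ∈ V^arc_ℚ` "the closed unit ball `I(^{S^±_{j+1}}F(^{n,∘}D_≻)_{v_ℚ})` … contains the image … of
both (1) the groups of units …, and (2) the closed balls of radius `π` …", each such ball containing "for
each `m' ≥ 1`, a subset that surjects, via the `m'`-th iterate of the log-link …, onto the subset of the
group of units … on which this iterate is defined". Typed as the CONTAINMENTS in the integral structure of
the data (a) — upper bounds only, no equality (that is the "semi"). HYPOTHESIS.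
[claim: Mochizuki2012, status: disputed] -/
@[claim "Mochizuki2012" "disputed"] def Ind3 : Prop :=
  (∀ (m : ℤ) (m' : ℕ) (j : T.Label) (vQ : T.VQ), T.IsNon vQ → C.unitImage m m' j vQ ⊆ D.shellPk j vQ) ∧
  (∀ (m : ℤ) (j : T.Label) (vQ : T.VQ), ¬ T.IsNon vQ →
    C.unitImage m 0 j vQ ⊆ D.shellPk j vQ ∧ C.ballImage m j vQ ⊆ D.shellPk j vQ ∧
    ∀ m' : ℕ, 1 ≤ m' → C.unitImage (m - m') m' j vQ ⊆ C.ballImage m j vQ)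

/-- **(ii), final clause** (p. 156): "Finally, as one varies `m ∈ ℤ`, the isomorphisms of (a) are
[precisely!] compatible, relative to the log-links of the `n`-th column …, with the respective log-volumes
[cf. Proposition 3.9, (iv)]": the transported holomorphic log-volumes at `(n,m)` and `(n,m+1)` agree on
the admissible regions of the data (a). HYPOTHESIS (but see `logvolPrecise_of_kummerA`).
[claim: Mochizuki2012, status: disputed] -/
@[claim "Mochizuki2012" "disputed"] def LogvolPrecise : Prop :=
  ∀ (m : ℤ) (j : T.Label) (vQ : T.VQ) (A : Set (L.Packet j vQ)),
    D.Adm j vQ A → C.frobLogvol (m + 1) j vQ A = C.frobLogvol m j vQ A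

/-- BOOKKEEPING: the final clause of (ii) follows from (a)'s compatibility with log-volumes at each `m`
separately — both sides read the one mono-analytic log-volume of the coric data. (The content of the
printed "[precisely!]" is thus in (a) + Prop. 3.9 (ii)/(iv), not an extra constraint, at this level.)
[folklore] -/
theorem logvolPrecise_of_kummerA (h : C.KummerA D) : C.LogvolPrecise D := by
  intro m j vQ A hA
  rw [(h (m + 1) j vQ A hA).2, (h m j vQ A hA).2]

/-- Under (ii) (b), the mutual compatibility of the splitting-monoid isomorphisms (first conjunct of
`MutualCompat`) is automatic: every `frobΨ m` is the coric `Ψ`. [folklore] -/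
theorem mutualCompat_psi_of_kummerB (h : C.KummerB D) (m : ℤ) (v : T.V) (hv : v ∈ T.Vbad) :
    C.frobΨ (m + 1) v hv = C.frobΨ m v hv := by
  rw [h (m + 1) v hv, h m v hv]

/-- Under (ii) (b) and (c), `MutualCompat` holds (bookkeeping: all transported data coincide with the
coric data). [folklore] -/
theorem mutualCompat_of_kummerB_kummerC (hb : C.KummerB D) (hc : C.KummerC D) : C.MutualCompat :=
  ⟨fun m v hv => C.mutualCompat_psi_of_kummerB D hb m v hv, fun m j => by rw [hc (m + 1) j, hc m j]⟩

/-- (Ind3), nonarchimedean part, in the form downstream estimates use ([IUTchIV] Thm. 1.10 Step (v):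
"(Ind3) is taken into account by the fact that we are considering upper bounds"): every unit-group image,
from every `m` and every iterate, lies in the ONE integral structure `I(^{S^±_{j+1}};^{n,∘}D⊢_{v_ℚ})`.
[claim: Mochizuki2012, status: disputed] -/
theorem unitImage_subset_of_ind3 (h : C.Ind3 D) {vQ : T.VQ} (hv : T.IsNon vQ) (m : ℤ) (m' : ℕ)
    (j : T.Label) : C.unitImage m m' j vQ ⊆ D.shellPk j vQ :=
  h.1 m m' j vQ hv

/-- The union over all `(m, m')` of the unit-group images is bounded above by the integral structure —
the "upper semi-compatibility" as ONE containment. [claim: Mochizuki2012, status: disputed] -/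
theorem iUnion_unitImage_subset_of_ind3 (h : C.Ind3 D) {vQ : T.VQ} (hv : T.IsNon vQ) (j : T.Label) :
    (⋃ p : ℤ × ℕ, C.unitImage p.1 p.2 j vQ) ⊆ D.shellPk j vQ :=
  Set.iUnion_subset fun p => h.1 p.1 p.2 j vQ hv

/-- **Theorem 3.11 (ii)** for the column `n` against the data of the vertical line `n`, as one `Prop`:
(a), (b), (c), the mutual compatibility, (Ind3), and the final log-volume clause. HYPOTHESIS, never
asserted here. [claim: Mochizuki2012, status: disputed] -/
@[claim "Mochizuki2012" "disputed"] def PartII : Prop :=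
  C.KummerA D ∧ C.KummerB D ∧ C.KummerC D ∧ C.MutualCompat ∧ C.Ind3 D ∧ C.LogvolPrecise D

/-- The redundancy made explicit: (ii) is equivalent to its first three items plus (Ind3); the mutual
compatibility and the final clause are consequences at this level of typing. [folklore] -/
theorem partII_iff : C.PartII D ↔ C.KummerA D ∧ C.KummerB D ∧ C.KummerC D ∧ C.Ind3 D := by
  constructor
  · rintro ⟨ha, hb, hc, -, h3, -⟩; exact ⟨ha, hb, hc, h3⟩
  · rintro ⟨ha, hb, hc, h3⟩
    exact ⟨ha, hb, hc, C.mutualCompat_of_kummerB_kummerC D hb hc, h3, C.logvolPrecise_of_kummerA D ha⟩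

end Column

/-! ## 3. The situation of Theorem 3.11 with its columns -/

/-- "The situation of Theorem 3.11", (i)+(ii)-part: a `Situation` (index data, coric log-shells, the data
(a)(b)(c) of every vertical line) together with, for every `n ∈ ℤ`, the Frobenius-like data of the `n`-th
column seen on the coric packets. [claim: Mochizuki2012, status: disputed] -/
structure LatticeSituation (T : ThetaIndex) extends Situation T where
  /-- the `n`-th column `{^{n,m}HT^{Θ±ell NF}}_{m ∈ ℤ}`, for every `n` -/
  col : ℤ → Column L

namespace LatticeSituation

variable (S : LatticeSituation T)

/-- **Theorem 3.11 (ii)** of the situation: for every `n`, the log-Kummer correspondence of the `n`-th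
column with the vertically coric data of the line `n`. HYPOTHESIS. [claim: Mochizuki2012, status: disputed] -/
@[claim "Mochizuki2012" "disputed"] def PartII : Prop := ∀ n : ℤ, (S.col n).PartII (S.D n)

/-- **(Ind3)** of the situation (every column). HYPOTHESIS. [claim: Mochizuki2012, status: disputed] -/
@[claim "Mochizuki2012" "disputed"] def Ind3 : Prop := ∀ n : ℤ, (S.col n).Ind3 (S.D n)

/-- (ii) contains (Ind3). [folklore] -/
theorem ind3_of_partII (h : S.PartII) : S.Ind3 := fun n => (h n).2.2.2.2.1

/-- Under (i) and (ii) (b): the Frobenius-like splitting monoid of ANY `(n', m)` — e.g. the one whose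
generators define the Θ-pilot object at `(n', m)` (Def. 3.8 (i)) — is, after Kummer transport, among the
possible images `^{n,∘}R^{LGP}` of the line-`n` data, in the sense that the data it belongs to lies in that
class. This is the shape in which Cor. 3.12 reads "the possible images of a Θ-pilot object … relative to
the relevant Kummer isomorphisms [cf. Theorem 3.11, (ii)], in the multiradial representation of Theorem
3.11, (i)". [claim: Mochizuki2012, status: disputed] -/
theorem frobPsi_mem_possibleImages (hi : S.MultiradialCompat) (hii : S.PartII) (n n' m : ℤ)
    (v : T.V) (hv : v ∈ T.Vbad) :
    ∃ D' ∈ S.RLGP n, (S.col n').frobΨ m v hv = D'.Ψ v hv :=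
  ⟨S.D n', S.mem_RLGP_of_multiradialCompat hi n n', (hii n').2.1 m v hv⟩

end LatticeSituation

end Thm311

end IUTFork

end Summit.ABC

end
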